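import Literature.NumberTheory.Rogawski1990.RankOneUnstableTransferNonsplitCMOfCore   -- ★ A-p19 (g22): `normOne_frame_of_mem_centralizer` (+ ★ `LocalStableClassesHTwo` → `…NonsplitRankTwo`)
import Literature.NumberTheory.Automorphic.LocalUnitaryGroupCongr                      -- ★ `cmDatumLocalCongr`, `coe_cmDatumLocalCongr_apply`
import Literature.NumberTheory.Automorphic.QuadraticLocalNormGroupNonsplit             -- ★ `exists_conjLocal_eq_not_exists_norm`
import HarnessLib

/-!
# A STABLE PARTNER MAP on an elliptic regular torus of `H_v = U(Φ₂) × U(Φ₁)` at a non-split place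
# (Rogawski 1990, §3.5 Prop. 3.5.2 (c), §3.6, Lemma 4.9.3; Labesse–Langlands 1979, §2)

Topic `NumberTheory/Rogawski1990`; namespace `Literature.NumberTheory.Rogawski1990`.  THEOREMS ONLY (no definition, no named fact, no instance,
no notation, no `sorry`).  Cell `pub/hodgecm-mathlib`, crux H413 = stmt-HodgeConjecture-24833, road «R1LL-tree» (rank-one unstable transfer letter,
Rogawski Lemma 4.9.3 ∕ Labesse–Langlands §2); architect A-p16 (g27) RULING A-8 (b): the two SOCKETS `τ` ∕ `hdense` of ★ F0P3-p01 (g13)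
`rankOneUnstable_core_inert_of_eventually` (`RankOneUnstableTransferInertCore`), in that theorem's binder shapes.  Hand: F0P2-p01 (g10).
HONEST LABEL: HC_CM is proved only modulo the printed citations until rung 0 closes; this file is unconditional local algebra ∕ topology.

THE PRINT.  [Rogawski1990, §3.5 Prop. 3.5.2 (c) p. 29; §3.6 pp. 31–32]: for the anisotropic torus `T = Z(t₀) ≅ E¹ × E¹ (× E¹)` of a regular elliptic
`t₀ ∈ H_v`, `v` non-split, the stable class of every REGULAR `t ∈ T` contains exactly two `H_v`-classes, and the second class is obtained from the
first by ONE stable conjugator that does not depend on `t`: a similitude `T_r = diag(1, r)` of `Φ₂ = antidiag(1, 1)` with a NON-NORM multiplier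
`r ∈ F_v^× ∖ N E_v^×` (`ᵗ(σ T_r) Φ₂ T_r = r Φ₂`, so `Ad T_r` is an automorphism of `U(Φ₂)(F_v)`; it moves the eigenvector lengths by `r`, which
flips the norm test of [Prop. 3.5.2 (c)]).  [Rogawski1990, §4.9 Lemma 4.9.3 p. 56] ∕ [LabesseLanglands1979, §2]: the germ argument near a singular
`t ∈ T` runs through REGULAR `t' → t` — the regular locus is dense in `T` (here: `t · (P diag(u_N, 1) P⁻¹, 1) → t` along a norm-one sequence `u_N → 1`,
`u_N ≠ 1`, ★ `exists_normOne_seq`).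

WHAT IS PROVED (`L` CM, `v` a finite place of `L⁺` with ONE place `w` of `L` above it, `H_v = U(Φ₂)(L⁺_v) × U(Φ₁)(L⁺_v)` on the ★ `cmDatum` carriers,
`t₀ ∈ H_v` with `t₀.1` regular and an eigenframe `t₀.1·P = P·diag d`, `σ(dᵢ) dᵢ = 1` — the binders of ★ `rankOneUnstable_core_inert_of_eventually`):
* §1 `formCongr_diagonal_antidiagTwo` — `diag(1, r)` is a similitude of `Φ₂,v` with multiplier `r` (`σ r = r`).
* §2 `partnerCongr_frame` (the frame of `T_r t.1 T_r⁻¹` is `T_r P`, same diagonal), `isLocalStablyConjH_partnerCongr_not_isConj` (stably conjugate, NOT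
  conjugate, at regular `t`; non-conjugacy = ★ `exists_unitary_conj_iff_forall_normTest_iff_rankTwo` with the norm test of `T_r` failing),
  **`exists_stablePartner_congr`** (`e = (Ad T_r, id) : H_v ≃ₜ* H_v` with frame `P′ = T_r P`, architect RULING A-12 (b) exports) and
  **`exists_stablePartner`** — `∃ τ : Z(t₀) → H_v` continuous with `τ t` stably conjugate and NOT conjugate to `t` for every regular `t ∈ Z(t₀)`.
* §3 `toLocalRing_uniformizer_nonNorm` (`r₀ := ι_v ϖ_v` is a `σ`-fixed non-norm unit of valuation `exp(−1)` at `v` unramified), and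
  **`exists_stablePartner_congr_uniformizer`** — the same automorphism with THIS multiplier pinned (architect RULING A-15 (c)).
* (companion file `RankOneTorusRegularLocusDense`: the socket `hdense` — the regular locus `{t ∈ Z(t₀) | t.1 regular}` is dense in `Z(t₀)`.)

## References
* [Rogawski1990] J. D. Rogawski, *Automorphic Representations of Unitary Groups in Three Variables*, Ann. of Math. Stud. 123 (1990): §3.1 p. 19,
  §3.5 Prop. 3.5.2 (c) p. 29, §3.6 pp. 31–32, §4.9 Lemma 4.9.3 p. 56.
* [LabesseLanglands1979] J.-P. Labesse, R. P. Langlands, *L-indistinguishability for SL(2)*, Canad. J. Math. 31 (1979): §2.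
* [PlatonovRapinchuk1994] V. Platonov, A. Rapinchuk, *Algebraic Groups and Number Theory* (1994): §2.3 (similitudes and unitary groups).
-/

set_option autoImplicit false

noncomputable section

open Filter Topology NumberField IsDedekindDomain Polynomial Matrix
open scoped MatrixGroups

namespace Literature.NumberTheory.Rogawski1990

open Literature.NumberTheory.Automorphic Literature.NumberTheory.Automorphic.UnitaryGroup Literature.NumberTheory.GaloisRepresentations
open Literature.AlgebraicGeometry.ShimuraVarieties (unitaryGroup mem_unitaryGroup_iff)

section Helpers

/-- `(X − a)(X − b)` separable ⇒ `a ≠ b`. [folklore] -/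
private theorem ne_of_separable_X_sub_C_mul₁₀ {K : Type*} [Field K] {a b : K} (h : ((X - C a) * (X - C b)).Separable) : a ≠ b := by
  rintro rfl
  exact Polynomial.not_isUnit_X_sub_C a (isCoprime_self.1 h.isCoprime)

/-- `![a, b]` is injective when `a ≠ b`. [folklore] -/
private theorem injective_vecCons_two₁₀ {K : Type*} {a b : K} (h : a ≠ b) : Function.Injective ![a, b] := by
  intro i j hij
  fin_cases i <;> fin_cases j
  · rfl
  · exact absurd hij h
  · exact absurd hij.symm h
  · rfl

variable (L : Type) [Field L] [NumberField L] [IsCMField L] (v : HeightOneSpectrum (𝓞 ↥(maximalRealSubfield L)))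

omit [IsCMField L] in
/-- The local form of `Φ₂` over `L_v` is the literal `antidiag(1, 1)`. [cite: Rogawski1990, §3.5 p. 29] -/
private theorem antidiagTwo_map_algebraMap₁₀ :
    (Matrix.of fun i j : Fin 2 => if i.val + j.val + 1 = 2 then (1 : L) else 0).map (algebraMap L (LocalRing L v)) =
      Matrix.of fun i j : Fin 2 => if i.val + j.val + 1 = 2 then (1 : LocalRing L v) else 0 := by
  ext i j
  simp only [map_apply, of_apply]
  split_ifs <;> simp

/-! ## §1 `diag(1, r)` is a similitude of `Φ₂` with multiplier `r` -/

/-- **`ᵗ(σ diag(1, r)) · Φ₂ · diag(1, r) = r • Φ₂`** for `σ r = r`: `diag(1, r)` is a similitude of `Φ₂ = antidiag(1, 1)` with multiplier `r`.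
[cite: Rogawski1990, §3.5 Prop. 3.5.2 (a) p. 29] [cite: PlatonovRapinchuk1994, §2.3] -/
theorem formCongr_diagonal_antidiagTwo {r : LocalRing L v} (hr : IsUnit r) (hrσ : conjLocal L (IsCMField.complexConj L) v r = r) :
    formCongr (conjLocal L (IsCMField.complexConj L) v) (glDiagonal 2 (LocalRing L v) ![1, hr.unit])
        ((Matrix.of fun i j : Fin 2 => if i.val + j.val + 1 = 2 then (1 : L) else 0).map (algebraMap L (LocalRing L v))) =
      r • (Matrix.of fun i j : Fin 2 => if i.val + j.val + 1 = 2 then (1 : L) else 0).map (algebraMap L (LocalRing L v)) := by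
  rw [antidiagTwo_map_algebraMap₁₀]
  have hT : (glDiagonal 2 (LocalRing L v) ![1, hr.unit]).val = diagonal ![(1 : LocalRing L v), r] := by
    rw [coe_glDiagonal]
    congr 1
    funext k
    fin_cases k <;> simp
  rw [formCongr, hT, diagonal_map (map_zero _), diagonal_transpose]
  ext i j
  fin_cases i <;> fin_cases j <;> simp [Matrix.mul_apply, Fin.sum_univ_two, diagonal, of_apply, hrσ]

end Helpers

section Partner

variable (L : Type) [Field L] [NumberField L] [IsCMField L] (v : HeightOneSpectrum (𝓞 ↥(maximalRealSubfield L)))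

/-- At a place with ONE prime of `L` above it, that prime is fixed by complex conjugation (local copy of ★ `smul_eq_of_subsingleton_placesOver`).
[cite: CasselsFrohlichANT1967, Ch. VII Prop. 1.2 (ii)] -/
private theorem smul_eq_of_subsingleton_placesOver₁₀ (hv : Subsingleton (PlacesOver L v)) (w : PlacesOver L v) :
    IsCMField.complexConj L • w.1 = w.1 := by
  have hmem : (IsCMField.complexConj L • w.1).under (𝓞 ↥(maximalRealSubfield L)) = v := by
    rw [HeightOneSpectrum.under_algEquiv_smul]; exact w.2
  exact congrArg Subtype.val (Subsingleton.elim (⟨IsCMField.complexConj L • w.1, hmem⟩ : PlacesOver L v) w)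

/-! ## §2 The stable partner `e = (Ad T_r, id)`, an automorphism of `H_v`, and its restriction `τ` to the torus `Z(t₀)` -/

/-- **THE FRAME OF `T_r t.1 T_r⁻¹` IS `T_r P`, WITH THE DIAGONAL OF `t.1`** (export `hτP` of architect RULING A-12 (b)): for `t ∈ Z(t₀)` (framed by `P` with the
norm-one diagonal `τᵢ t = (P⁻¹ t.1 P)ᵢᵢ` of ★ `normOne_frame_of_mem_centralizer`) and the similitude `T_r = diag(1, r)` of §1, `(T_r t.1 T_r⁻¹)·(T_r P) = (T_r P)·diag(τ₀ t, τ₁ t)`.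
[cite: Rogawski1990, §3.6 pp. 31–32] [cite: PlatonovRapinchuk1994, §2.3] -/
theorem partnerCongr_frame (w : PlacesOver L v) (hw : IsCMField.complexConj L • w.1 = w.1) {r : LocalRing L v} (hru : IsUnit r)
    (hrσ : conjLocal L (IsCMField.complexConj L) v r = r)
    (t₀ : ((cmDatum L 2 (Matrix.of fun i j : Fin 2 => if i.val + j.val + 1 = 2 then (1 : L) else 0)).Local v × (cmDatum L 1 (Matrix.of fun i j : Fin 1 => if i.val + j.val + 1 = 1 then (1 : L) else 0)).Local v)) (P : GL (Fin 2) (LocalRing L v)) (d : Fin 2 → (LocalRing L v)) (ht₀ : IsRegularElt (t₀.1.val : GL (Fin 2) (LocalRing L v)))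
    (hP : (t₀.1.val.val : Matrix (Fin 2) (Fin 2) (LocalRing L v)) * P.val = P.val * Matrix.diagonal d) (hd1 : ∀ i, conjLocal L (IsCMField.complexConj L) v (d i) * d i = 1)
    (t : ↥(Subgroup.centralizer ({t₀} : Set ((cmDatum L 2 (Matrix.of fun i j : Fin 2 => if i.val + j.val + 1 = 2 then (1 : L) else 0)).Local v × (cmDatum L 1 (Matrix.of fun i j : Fin 1 => if i.val + j.val + 1 = 1 then (1 : L) else 0)).Local v)))) :
    (((cmDatumLocalCongr L v (glDiagonal 2 (LocalRing L v) ![1, hru.unit]) hru (formCongr_diagonal_antidiagTwo L v hru hrσ)) (t : ((cmDatum L 2 (Matrix.of fun i j : Fin 2 => if i.val + j.val + 1 = 2 then (1 : L) else 0)).Local v × (cmDatum L 1 (Matrix.of fun i j : Fin 1 => if i.val + j.val + 1 = 1 then (1 : L) else 0)).Local v)).1).val.val : Matrix (Fin 2) (Fin 2) (LocalRing L v)) * ((glDiagonal 2 (LocalRing L v) ![1, hru.unit]) * P).val =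
      ((glDiagonal 2 (LocalRing L v) ![1, hru.unit]) * P).val * Matrix.diagonal ![((P⁻¹).val * ((t : ((cmDatum L 2 (Matrix.of fun i j : Fin 2 => if i.val + j.val + 1 = 2 then (1 : L) else 0)).Local v × (cmDatum L 1 (Matrix.of fun i j : Fin 1 => if i.val + j.val + 1 = 1 then (1 : L) else 0)).Local v)).1.val.val : Matrix (Fin 2) (Fin 2) (LocalRing L v)) * P.val) 0 0, ((P⁻¹).val * ((t : ((cmDatum L 2 (Matrix.of fun i j : Fin 2 => if i.val + j.val + 1 = 2 then (1 : L) else 0)).Local v × (cmDatum L 1 (Matrix.of fun i j : Fin 1 => if i.val + j.val + 1 = 1 then (1 : L) else 0)).Local v)).1.val.val : Matrix (Fin 2) (Fin 2) (LocalRing L v)) * P.val) 1 1] := by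
  obtain ⟨-, hPt⟩ := normOne_frame_of_mem_centralizer L v w hw t₀ P d ht₀ hP hd1 _ t.2
  have hTT : ((glDiagonal 2 (LocalRing L v) ![1, hru.unit])⁻¹).val * (glDiagonal 2 (LocalRing L v) ![1, hru.unit]).val = 1 := by
    rw [← Units.val_mul, inv_mul_cancel, Units.val_one]
  rw [coe_cmDatumLocalCongr_apply, Units.val_mul, Units.val_mul, Units.val_mul]
  calc (glDiagonal 2 (LocalRing L v) ![1, hru.unit]).val * ((t : ((cmDatum L 2 (Matrix.of fun i j : Fin 2 => if i.val + j.val + 1 = 2 then (1 : L) else 0)).Local v × (cmDatum L 1 (Matrix.of fun i j : Fin 1 => if i.val + j.val + 1 = 1 then (1 : L) else 0)).Local v)).1.val.val : Matrix (Fin 2) (Fin 2) (LocalRing L v)) * ((glDiagonal 2 (LocalRing L v) ![1, hru.unit])⁻¹).val * ((glDiagonal 2 (LocalRing L v) ![1, hru.unit]).val * P.val)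
      = (glDiagonal 2 (LocalRing L v) ![1, hru.unit]).val * (((t : ((cmDatum L 2 (Matrix.of fun i j : Fin 2 => if i.val + j.val + 1 = 2 then (1 : L) else 0)).Local v × (cmDatum L 1 (Matrix.of fun i j : Fin 1 => if i.val + j.val + 1 = 1 then (1 : L) else 0)).Local v)).1.val.val : Matrix (Fin 2) (Fin 2) (LocalRing L v)) * ((((glDiagonal 2 (LocalRing L v) ![1, hru.unit])⁻¹).val * (glDiagonal 2 (LocalRing L v) ![1, hru.unit]).val) * P.val)) := by
        simp only [Matrix.mul_assoc]
    _ = (glDiagonal 2 (LocalRing L v) ![1, hru.unit]).val * (P.val * Matrix.diagonal ![((P⁻¹).val * ((t : ((cmDatum L 2 (Matrix.of fun i j : Fin 2 => if i.val + j.val + 1 = 2 then (1 : L) else 0)).Local v × (cmDatum L 1 (Matrix.of fun i j : Fin 1 => if i.val + j.val + 1 = 1 then (1 : L) else 0)).Local v)).1.val.val : Matrix (Fin 2) (Fin 2) (LocalRing L v)) * P.val) 0 0, ((P⁻¹).val * ((t : ((cmDatum L 2 (Matrix.of fun i j : Fin 2 => if i.val + j.val + 1 = 2 then (1 : L) else 0)).Local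 v × (cmDatum L 1 (Matrix.of fun i j : Fin 1 => if i.val + j.val + 1 = 1 then (1 : L) else 0)).Local v)).1.val.val : Matrix (Fin 2) (Fin 2) (LocalRing L v)) * P.val) 1 1]) := by rw [hTT, Matrix.one_mul, hPt]
    _ = (glDiagonal 2 (LocalRing L v) ![1, hru.unit]).val * P.val * Matrix.diagonal ![((P⁻¹).val * ((t : ((cmDatum L 2 (Matrix.of fun i j : Fin 2 => if i.val + j.val + 1 = 2 then (1 : L) else 0)).Local v × (cmDatum L 1 (Matrix.of fun i j : Fin 1 => if i.val + j.val + 1 = 1 then (1 : L) else 0)).Local v)).1.val.val : Matrix (Fin 2) (Fin 2) (LocalRing L v)) * P.val) 0 0, ((P⁻¹).val * ((t : ((cmDatum L 2 (Matrix.of fun i j : Fin 2 => if i.val + j.val + 1 = 2 then (1 : L) else 0)).Local v × (cmDatum L 1 (Matrix.of fun i j : Fin 1 => if i.val + j.val + 1 = 1 then (1 : L) else 0)).Local v)).1.val.val : Matrix (Fin 2) (Fin 2) (LocalRing L v)) * P.val) 1 1] := (Matrix.mul_assoc _ _ _).symm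

/-- **`(T_r t.1 T_r⁻¹, t.2)` IS STABLY CONJUGATE AND NOT CONJUGATE TO `t`** for every `t ∈ Z(t₀)` with `t.1` regular, when `r` is a `σ`-fixed NON-NORM unit:
`T_r` is a stable conjugator in `GL₂(L_v)` (★ `coe_cmDatumLocalCongr_apply`, ★ `isStablyConj_iff`) and the `U(Φ₁)`-components agree; `T_r` multiplies the
eigenvector length `(Φ₂)_{P,00}` by the non-norm `r`, so by the norm-test criterion ★ `exists_unitary_conj_iff_forall_normTest_iff_rankTwo` (against `g = 1`,
★ `normTest_one_rankTwo`; the frame of `t` is ★ `normOne_frame_of_mem_centralizer`, its two eigenvalues differ by regularity) no element of `U(Φ₂)(L⁺_v)`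
conjugates `t.1` to `T_r t.1 T_r⁻¹` — the «`Σ ε_j = 0`, two classes» of [Prop. 3.5.2 (c)] at `r = 2`.
[cite: Rogawski1990, §3.5 Prop. 3.5.2 (c) p. 29; §3.6 pp. 31–32] [cite: Kottwitz1986, §7] -/
theorem isLocalStablyConjH_partnerCongr_not_isConj (w : PlacesOver L v) (hw : IsCMField.complexConj L • w.1 = w.1) {r : LocalRing L v} (hru : IsUnit r)
    (hrσ : conjLocal L (IsCMField.complexConj L) v r = r) (hrn : ¬ ∃ z : LocalRing L v, IsUnit z ∧ r = conjLocal L (IsCMField.complexConj L) v z * z)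
    (t₀ : ((cmDatum L 2 (Matrix.of fun i j : Fin 2 => if i.val + j.val + 1 = 2 then (1 : L) else 0)).Local v × (cmDatum L 1 (Matrix.of fun i j : Fin 1 => if i.val + j.val + 1 = 1 then (1 : L) else 0)).Local v)) (P : GL (Fin 2) (LocalRing L v)) (d : Fin 2 → (LocalRing L v)) (ht₀ : IsRegularElt (t₀.1.val : GL (Fin 2) (LocalRing L v)))
    (hP : (t₀.1.val.val : Matrix (Fin 2) (Fin 2) (LocalRing L v)) * P.val = P.val * Matrix.diagonal d) (hd1 : ∀ i, conjLocal L (IsCMField.complexConj L) v (d i) * d i = 1)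
    (t : ↥(Subgroup.centralizer ({t₀} : Set ((cmDatum L 2 (Matrix.of fun i j : Fin 2 => if i.val + j.val + 1 = 2 then (1 : L) else 0)).Local v × (cmDatum L 1 (Matrix.of fun i j : Fin 1 => if i.val + j.val + 1 = 1 then (1 : L) else 0)).Local v)))) (ht : IsRegularElt ((t : ((cmDatum L 2 (Matrix.of fun i j : Fin 2 => if i.val + j.val + 1 = 2 then (1 : L) else 0)).Local v × (cmDatum L 1 (Matrix.of fun i j : Fin 1 => if i.val + j.val + 1 = 1 then (1 : L) else 0)).Local v)).1.val : GL (Fin 2) (LocalRing L v))) :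
    IsLocalStablyConjH L v (t : ((cmDatum L 2 (Matrix.of fun i j : Fin 2 => if i.val + j.val + 1 = 2 then (1 : L) else 0)).Local v × (cmDatum L 1 (Matrix.of fun i j : Fin 1 => if i.val + j.val + 1 = 1 then (1 : L) else 0)).Local v)) ((cmDatumLocalCongr L v (glDiagonal 2 (LocalRing L v) ![1, hru.unit]) hru (formCongr_diagonal_antidiagTwo L v hru hrσ)) (t : ((cmDatum L 2 (Matrix.of fun i j : Fin 2 => if i.val + j.val + 1 = 2 then (1 : L) else 0)).Local v × (cmDatum L 1 (Matrix.of fun i j : Fin 1 => if i.val + j.val + 1 = 1 then (1 : L) else 0)).Local v)).1, (t : ((cmDatum L 2 (Matrix.of fun i j : Fin 2 => if i.val + j.val + 1 = 2 then (1 : L) else 0)).Local v × (cmDatum L 1 (Matrix.of fun i j : Fin 1 => if i.val + j.val + 1 = 1 then (1 : L) else 0)).Local v)).2) ∧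
      ¬ IsConj (t : ((cmDatum L 2 (Matrix.of fun i j : Fin 2 => if i.val + j.val + 1 = 2 then (1 : L) else 0)).Local v × (cmDatum L 1 (Matrix.of fun i j : Fin 1 => if i.val + j.val + 1 = 1 then (1 : L) else 0)).Local v)) ((cmDatumLocalCongr L v (glDiagonal 2 (LocalRing L v) ![1, hru.unit]) hru (formCongr_diagonal_antidiagTwo L v hru hrσ)) (t : ((cmDatum L 2 (Matrix.of fun i j : Fin 2 => if i.val + j.val + 1 = 2 then (1 : L) else 0)).Local v × (cmDatum L 1 (Matrix.of fun i j : Fin 1 => if i.val + j.val + 1 = 1 then (1 : L) else 0)).Local v)).1, (t : ((cmDatum L 2 (Matrix.of fun i j : Fin 2 => if i.val + j.val + 1 = 2 then (1 : L) else 0)).Local v × (cmDatum L 1 (Matrix.of fun i j : Fin 1 => if i.val + j.val + 1 = 1 then (1 : L) else 0)).Local v)).2) := by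
  classical
  have hc1 : IsCMField.complexConj L ≠ 1 := IsCMField.complexConj_ne_one L
  letI : Field (LocalRing L v) := (LocalRing.isField_of_smul_eq (IsCMField.complexConj L) hc1 w hw).toField
  obtain ⟨αg, hα0, hcα, -⟩ := cmQuadraticGenerator_spec L
  have hH := adelicForm_antidiagTwo_local_hermitian L v
  have hHd := isUnit_det_adelicForm_antidiagTwo_local L v
  have hU : ∀ g : ((cmDatum L 2 (Matrix.of fun i j : Fin 2 => if i.val + j.val + 1 = 2 then (1 : L) else 0)).Local v), g.val ∈ unitaryGroup (conjLocal L (IsCMField.complexConj L) v) ((adelicForm L 2 (Matrix.of fun i j : Fin 2 => if i.val + j.val + 1 = 2 then (1 : L) else 0)).map (adeleToLocal L v)) :=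
    fun g => (mem_unitaryGroup_iff (σ := (conjLocal L (IsCMField.complexConj L) v)) (H := ((adelicForm L 2 (Matrix.of fun i j : Fin 2 => if i.val + j.val + 1 = 2 then (1 : L) else 0)).map (adeleToLocal L v))) (g := g.val)).2 ((mem_unitaryGroupOfForm_iff (σ := (conjLocal L (IsCMField.complexConj L) v)) (J := ((adelicForm L 2 (Matrix.of fun i j : Fin 2 => if i.val + j.val + 1 = 2 then (1 : L) else 0)).map (adeleToLocal L v))) (g := g.val)).1 g.2)
  have hsim := formCongr_diagonal_antidiagTwo L v hru hrσ
  have hEval : ∀ x : ((cmDatum L 2 (Matrix.of fun i j : Fin 2 => if i.val + j.val + 1 = 2 then (1 : L) else 0)).Local v), ((cmDatumLocalCongr L v (glDiagonal 2 (LocalRing L v) ![1, hru.unit]) hru (formCongr_diagonal_antidiagTwo L v hru hrσ)) x).val = (glDiagonal 2 (LocalRing L v) ![1, hru.unit]) * x.val * (glDiagonal 2 (LocalRing L v) ![1, hru.unit])⁻¹ := fun x => coe_cmDatumLocalCongr_apply L v _ hru hsim x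
  -- the frame of `t`: `t.1·P = P·diag(u)`, `u` injective of norm one
  obtain ⟨hn1, hPt⟩ := normOne_frame_of_mem_centralizer L v w hw t₀ P d ht₀ hP hd1 _ t.2
  have hinj : Function.Injective ![((P⁻¹).val * ((t : ((cmDatum L 2 (Matrix.of fun i j : Fin 2 => if i.val + j.val + 1 = 2 then (1 : L) else 0)).Local v × (cmDatum L 1 (Matrix.of fun i j : Fin 1 => if i.val + j.val + 1 = 1 then (1 : L) else 0)).Local v)).1.val.val : Matrix (Fin 2) (Fin 2) (LocalRing L v)) * P.val) 0 0, ((P⁻¹).val * ((t : ((cmDatum L 2 (Matrix.of fun i j : Fin 2 => if i.val + j.val + 1 = 2 then (1 : L) else 0)).Local v × (cmDatum L 1 (Matrix.of fun i j : Fin 1 => if i.val + j.val + 1 = 1 then (1 : L) else 0)).Local v)).1.val.val : Matrix (Fin 2) (Fin 2) (LocalRing L v)) * P.val) 1 1] := by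
    have hχ := finCharpolyTwo_eq_of_frame P hPt
    have hsep : (finCharpolyTwo L v (t : ((cmDatum L 2 (Matrix.of fun i j : Fin 2 => if i.val + j.val + 1 = 2 then (1 : L) else 0)).Local v × (cmDatum L 1 (Matrix.of fun i j : Fin 1 => if i.val + j.val + 1 = 1 then (1 : L) else 0)).Local v))).Separable := ht
    rw [hχ] at hsep
    exact injective_vecCons_two₁₀ (ne_of_separable_X_sub_C_mul₁₀ hsep)
  -- the norm test of `T_r` FAILS (`(Φ₂)_{T_r P,00} = r · (Φ₂)_{P,00}`, `r` not a norm), that of `1` passes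
  have hTw : twistGram (conjLocal L (IsCMField.complexConj L) v) ((adelicForm L 2 (Matrix.of fun i j : Fin 2 => if i.val + j.val + 1 = 2 then (1 : L) else 0)).map (adeleToLocal L v)) (glDiagonal 2 (LocalRing L v) ![1, hru.unit]).val = r • ((adelicForm L 2 (Matrix.of fun i j : Fin 2 => if i.val + j.val + 1 = 2 then (1 : L) else 0)).map (adeleToLocal L v)) := by
    rw [twistGram_def, adelicForm_map_adeleToLocal]; exact hsim
  have hTP : twistGram (conjLocal L (IsCMField.complexConj L) v) ((adelicForm L 2 (Matrix.of fun i j : Fin 2 => if i.val + j.val + 1 = 2 then (1 : L) else 0)).map (adeleToLocal L v)) ((glDiagonal 2 (LocalRing L v) ![1, hru.unit]).val * P.val) 0 0 = r * twistGram (conjLocal L (IsCMField.complexConj L) v) ((adelicForm L 2 (Matrix.of fun i j : Fin 2 => if i.val + j.val + 1 = 2 then (1 : L) else 0)).map (adeleToLocal L v)) P.val 0 0 := by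
    rw [twistGram_mul, hTw, Matrix.mul_smul, Matrix.smul_mul, Matrix.smul_apply, smul_eq_mul, ← twistGram_def]
  have hX := twistGram_eigenframe_apply_ne_zero (conjLocal L (IsCMField.complexConj L) v) _ hHd.ne_zero (hU (t : ((cmDatum L 2 (Matrix.of fun i j : Fin 2 => if i.val + j.val + 1 = 2 then (1 : L) else 0)).Local v × (cmDatum L 1 (Matrix.of fun i j : Fin 1 => if i.val + j.val + 1 = 1 then (1 : L) else 0)).Local v)).1) hPt hinj hn1 (0 : Fin 2)
  have hfail : ¬ ∃ z : LocalRing L v, IsUnit z ∧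
      twistGram (conjLocal L (IsCMField.complexConj L) v) ((adelicForm L 2 (Matrix.of fun i j : Fin 2 => if i.val + j.val + 1 = 2 then (1 : L) else 0)).map (adeleToLocal L v)) ((glDiagonal 2 (LocalRing L v) ![1, hru.unit]).val * P.val) 0 0 = (conjLocal L (IsCMField.complexConj L) v) z * z * twistGram (conjLocal L (IsCMField.complexConj L) v) ((adelicForm L 2 (Matrix.of fun i j : Fin 2 => if i.val + j.val + 1 = 2 then (1 : L) else 0)).map (adeleToLocal L v)) P.val 0 0 := by
    rintro ⟨z, hz, h⟩
    rw [hTP] at h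
    exact hrn ⟨z, hz, mul_right_cancel₀ hX h⟩
  have hpass := normTest_one_rankTwo L v (IsCMField.complexConj L) (H := ((adelicForm L 2 (Matrix.of fun i j : Fin 2 => if i.val + j.val + 1 = 2 then (1 : L) else 0)).map (adeleToLocal L v))) (P := P) (0 : Fin 2)
  have hg1 : (1 : GL (Fin 2) (LocalRing L v)) * (t : ((cmDatum L 2 (Matrix.of fun i j : Fin 2 => if i.val + j.val + 1 = 2 then (1 : L) else 0)).Local v × (cmDatum L 1 (Matrix.of fun i j : Fin 1 => if i.val + j.val + 1 = 1 then (1 : L) else 0)).Local v)).1.val * 1⁻¹ ∈ unitaryGroup (conjLocal L (IsCMField.complexConj L) v) ((adelicForm L 2 (Matrix.of fun i j : Fin 2 => if i.val + j.val + 1 = 2 then (1 : L) else 0)).map (adeleToLocal L v)) := by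
    rw [inv_one, mul_one, one_mul]; exact hU _
  have hgT : (glDiagonal 2 (LocalRing L v) ![1, hru.unit]) * (t : ((cmDatum L 2 (Matrix.of fun i j : Fin 2 => if i.val + j.val + 1 = 2 then (1 : L) else 0)).Local v × (cmDatum L 1 (Matrix.of fun i j : Fin 1 => if i.val + j.val + 1 = 1 then (1 : L) else 0)).Local v)).1.val * (glDiagonal 2 (LocalRing L v) ![1, hru.unit])⁻¹ ∈ unitaryGroup (conjLocal L (IsCMField.complexConj L) v) ((adelicForm L 2 (Matrix.of fun i j : Fin 2 => if i.val + j.val + 1 = 2 then (1 : L) else 0)).map (adeleToLocal L v)) := by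
    rw [← hEval]; exact hU _
  have hcrit := exists_unitary_conj_iff_forall_normTest_iff_rankTwo L v (IsCMField.complexConj L) hcα hα0 w hw hH hHd (hU (t : ((cmDatum L 2 (Matrix.of fun i j : Fin 2 => if i.val + j.val + 1 = 2 then (1 : L) else 0)).Local v × (cmDatum L 1 (Matrix.of fun i j : Fin 1 => if i.val + j.val + 1 = 1 then (1 : L) else 0)).Local v)).1) hPt hinj hn1 hg1 hgT
  have hnot : ¬ ∃ w' : GL (Fin 2) (LocalRing L v), w' ∈ unitaryGroup (conjLocal L (IsCMField.complexConj L) v) ((adelicForm L 2 (Matrix.of fun i j : Fin 2 => if i.val + j.val + 1 = 2 then (1 : L) else 0)).map (adeleToLocal L v)) ∧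
      w' * ((1 : GL (Fin 2) (LocalRing L v)) * (t : ((cmDatum L 2 (Matrix.of fun i j : Fin 2 => if i.val + j.val + 1 = 2 then (1 : L) else 0)).Local v × (cmDatum L 1 (Matrix.of fun i j : Fin 1 => if i.val + j.val + 1 = 1 then (1 : L) else 0)).Local v)).1.val * 1⁻¹) * w'⁻¹ = (glDiagonal 2 (LocalRing L v) ![1, hru.unit]) * (t : ((cmDatum L 2 (Matrix.of fun i j : Fin 2 => if i.val + j.val + 1 = 2 then (1 : L) else 0)).Local v × (cmDatum L 1 (Matrix.of fun i j : Fin 1 => if i.val + j.val + 1 = 1 then (1 : L) else 0)).Local v)).1.val * (glDiagonal 2 (LocalRing L v) ![1, hru.unit])⁻¹ :=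
    fun hex => hfail ((hcrit.1 hex 0).2 hpass)
  refine ⟨?_, fun hconj => hnot ?_⟩
  · -- stable conjugacy: `T_r` conjugates `t.1` to `T_r t.1 T_r⁻¹` in `GL₂(L_v)`; the `U(Φ₁)`-components are equal
    exact (show IsStablyConj _ _ _ _ ∧ IsStablyConj _ _ _ _ from ⟨isStablyConj_iff.2 ⟨_, (hEval _).symm⟩, IsStablyConj.refl _⟩)
  · obtain ⟨c, hc⟩ := isConj_iff.1 hconj
    refine ⟨c.1.val, hU c.1, ?_⟩
    have h1 : (c * (t : ((cmDatum L 2 (Matrix.of fun i j : Fin 2 => if i.val + j.val + 1 = 2 then (1 : L) else 0)).Local v × (cmDatum L 1 (Matrix.of fun i j : Fin 1 => if i.val + j.val + 1 = 1 then (1 : L) else 0)).Local v)) * c⁻¹).1 = (cmDatumLocalCongr L v (glDiagonal 2 (LocalRing L v) ![1, hru.unit]) hru (formCongr_diagonal_antidiagTwo L v hru hrσ)) (t : ((cmDatum L 2 (Matrix.of fun i j : Fin 2 => if i.val + j.val + 1 = 2 then (1 : L) else 0)).Local v × (cmDatum L 1 (Matrix.of fun i j : Fin 1 => if i.val + j.val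 + 1 = 1 then (1 : L) else 0)).Local v)).1 := congrArg Prod.fst hc
    rw [inv_one, mul_one, one_mul, ← hEval, ← h1]
    rfl

/-- **THE STABLE PARTNER AUTOMORPHISM OF `H_v`** (strong form of the socket `τ` of ★ `rankOneUnstable_core_inert_of_eventually`, with the exports asked in
architect RULING A-12 (b)).  At a non-split `v`, for `t₀ ∈ H_v = U(Φ₂)(L⁺_v) × U(Φ₁)(L⁺_v)` with `t₀.1` regular and an eigenframe `t₀.1·P = P·diag d`, `σ(dᵢ) dᵢ = 1`,
there are a topological-group automorphism `e : H_v ≃ₜ* H_v` and a frame `P′` with: `(e a).2 = a.2`; for every `t ∈ Z(t₀)`, `(e t).1·P′ = P′·diag(τ₀ t, τ₁ t)` with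
the SAME diagonal `τᵢ t = (P⁻¹ t.1 P)ᵢᵢ` as ★ `normOne_frame_of_mem_centralizer`; and for every `t ∈ Z(t₀)` with `t.1` regular, `e t` is stably conjugate and NOT
conjugate to `t`.  Construction: `e = (Ad T_r, id)` (★ `cmDatumLocalCongr` along the similitude `T_r = diag(1, r)` of §1, `r` a `σ`-fixed NON-NORM unit —
★ `exists_conjLocal_eq_not_exists_norm`), `P′ = T_r P`; the two properties are `partnerCongr_frame` and `isLocalStablyConjH_partnerCongr_not_isConj`.
[cite: Rogawski1990, §3.5 Prop. 3.5.2 (c) p. 29; §3.6 pp. 31–32; §4.9 Lemma 4.9.3 p. 56] [cite: LabesseLanglands1979, §2] [cite: PlatonovRapinchuk1994, §2.3] -/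
theorem exists_stablePartner_congr (hv : Subsingleton (PlacesOver L v))
    (t₀ : ((cmDatum L 2 (Matrix.of fun i j : Fin 2 => if i.val + j.val + 1 = 2 then (1 : L) else 0)).Local v × (cmDatum L 1 (Matrix.of fun i j : Fin 1 => if i.val + j.val + 1 = 1 then (1 : L) else 0)).Local v)) (P : GL (Fin 2) (LocalRing L v)) (d : Fin 2 → (LocalRing L v)) (ht₀ : IsRegularElt (t₀.1.val : GL (Fin 2) (LocalRing L v)))
    (hP : (t₀.1.val.val : Matrix (Fin 2) (Fin 2) (LocalRing L v)) * P.val = P.val * Matrix.diagonal d) (hd1 : ∀ i, conjLocal L (IsCMField.complexConj L) v (d i) * d i = 1) :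
    ∃ (e : ((cmDatum L 2 (Matrix.of fun i j : Fin 2 => if i.val + j.val + 1 = 2 then (1 : L) else 0)).Local v × (cmDatum L 1 (Matrix.of fun i j : Fin 1 => if i.val + j.val + 1 = 1 then (1 : L) else 0)).Local v) ≃ₜ* ((cmDatum L 2 (Matrix.of fun i j : Fin 2 => if i.val + j.val + 1 = 2 then (1 : L) else 0)).Local v × (cmDatum L 1 (Matrix.of fun i j : Fin 1 => if i.val + j.val + 1 = 1 then (1 : L) else 0)).Local v)) (P' : GL (Fin 2) (LocalRing L v)),
      (∀ a : ((cmDatum L 2 (Matrix.of fun i j : Fin 2 => if i.val + j.val + 1 = 2 then (1 : L) else 0)).Local v × (cmDatum L 1 (Matrix.of fun i j : Fin 1 => if i.val + j.val + 1 = 1 then (1 : L) else 0)).Local v), (e a).2 = a.2) ∧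
      (∀ t : ↥(Subgroup.centralizer ({t₀} : Set ((cmDatum L 2 (Matrix.of fun i j : Fin 2 => if i.val + j.val + 1 = 2 then (1 : L) else 0)).Local v × (cmDatum L 1 (Matrix.of fun i j : Fin 1 => if i.val + j.val + 1 = 1 then (1 : L) else 0)).Local v))),
        ((e (t : ((cmDatum L 2 (Matrix.of fun i j : Fin 2 => if i.val + j.val + 1 = 2 then (1 : L) else 0)).Local v × (cmDatum L 1 (Matrix.of fun i j : Fin 1 => if i.val + j.val + 1 = 1 then (1 : L) else 0)).Local v))).1.val.val : Matrix (Fin 2) (Fin 2) (LocalRing L v)) * P'.val = P'.val * Matrix.diagonal ![((P⁻¹).val * ((t : ((cmDatum L 2 (Matrix.of fun i j : Fin 2 => if i.val + j.val + 1 = 2 then (1 : L) else 0)).Local v × (cmDatum L 1 (Matrix.of fun i j : Fin 1 => if i.val + j.val + 1 = 1 then (1 : L) else 0)).Local v)).1.val.val : Matrix (Fin 2) (Fin 2) (LocalRing L v)) * P.val) 0 0, ((P⁻¹).val * ((t : ((cmDatum L 2 (Matrix.of fun i j : Fin 2 => if i.val + j.val + 1 = 2 then (1 : L) else 0)).Local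 v × (cmDatum L 1 (Matrix.of fun i j : Fin 1 => if i.val + j.val + 1 = 1 then (1 : L) else 0)).Local v)).1.val.val : Matrix (Fin 2) (Fin 2) (LocalRing L v)) * P.val) 1 1]) ∧
      ∀ t : ↥(Subgroup.centralizer ({t₀} : Set ((cmDatum L 2 (Matrix.of fun i j : Fin 2 => if i.val + j.val + 1 = 2 then (1 : L) else 0)).Local v × (cmDatum L 1 (Matrix.of fun i j : Fin 1 => if i.val + j.val + 1 = 1 then (1 : L) else 0)).Local v))), IsRegularElt ((t : ((cmDatum L 2 (Matrix.of fun i j : Fin 2 => if i.val + j.val + 1 = 2 then (1 : L) else 0)).Local v × (cmDatum L 1 (Matrix.of fun i j : Fin 1 => if i.val + j.val + 1 = 1 then (1 : L) else 0)).Local v)).1.val : GL (Fin 2) (LocalRing L v)) →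
        IsLocalStablyConjH L v (t : ((cmDatum L 2 (Matrix.of fun i j : Fin 2 => if i.val + j.val + 1 = 2 then (1 : L) else 0)).Local v × (cmDatum L 1 (Matrix.of fun i j : Fin 1 => if i.val + j.val + 1 = 1 then (1 : L) else 0)).Local v)) (e (t : ((cmDatum L 2 (Matrix.of fun i j : Fin 2 => if i.val + j.val + 1 = 2 then (1 : L) else 0)).Local v × (cmDatum L 1 (Matrix.of fun i j : Fin 1 => if i.val + j.val + 1 = 1 then (1 : L) else 0)).Local v))) ∧ ¬ IsConj (t : ((cmDatum L 2 (Matrix.of fun i j : Fin 2 => if i.val + j.val + 1 = 2 then (1 : L) else 0)).Local v × (cmDatum L 1 (Matrix.of fun i j : Fin 1 => if i.val + j.val + 1 = 1 then (1 : L) else 0)).Local v)) (e (t : ((cmDatum L 2 (Matrix.of fun i j : Fin 2 => if i.val + j.val + 1 = 2 then (1 : L) else 0)).Local v × (cmDatum L 1 (Matrix.of fun i j : Fin 1 => if i.val + j.val + 1 = 1 then (1 : L) else 0)).Local v))) := by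
  classical
  obtain ⟨w⟩ := PlacesOver.nonempty L v
  have hw : IsCMField.complexConj L • w.1 = w.1 := smul_eq_of_subsingleton_placesOver₁₀ L v hv w
  obtain ⟨αg, hα0, hcα, -⟩ := cmQuadraticGenerator_spec L
  -- the similitude `T_r = diag(1, r)` with a non-norm multiplier `r`, and `e = (Ad T_r, id)`
  obtain ⟨r, hrσ, hru, hrn⟩ := exists_conjLocal_eq_not_exists_norm L v (IsCMField.complexConj L) hcα hα0 w hw
  let e : ((cmDatum L 2 (Matrix.of fun i j : Fin 2 => if i.val + j.val + 1 = 2 then (1 : L) else 0)).Local v × (cmDatum L 1 (Matrix.of fun i j : Fin 1 => if i.val + j.val + 1 = 1 then (1 : L) else 0)).Local v) ≃ₜ* ((cmDatum L 2 (Matrix.of fun i j : Fin 2 => if i.val + j.val + 1 = 2 then (1 : L) else 0)).Local v × (cmDatum L 1 (Matrix.of fun i j : Fin 1 => if i.val + j.val + 1 = 1 then (1 : L) else 0)).Local v) :=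
    { toFun := fun a => ((cmDatumLocalCongr L v (glDiagonal 2 (LocalRing L v) ![1, hru.unit]) hru (formCongr_diagonal_antidiagTwo L v hru hrσ)) a.1, a.2)
      invFun := fun a => ((cmDatumLocalCongr L v (glDiagonal 2 (LocalRing L v) ![1, hru.unit]) hru (formCongr_diagonal_antidiagTwo L v hru hrσ)).symm a.1, a.2)
      left_inv := fun a => Prod.ext ((cmDatumLocalCongr L v (glDiagonal 2 (LocalRing L v) ![1, hru.unit]) hru (formCongr_diagonal_antidiagTwo L v hru hrσ)).symm_apply_apply a.1) rfl
      right_inv := fun a => Prod.ext ((cmDatumLocalCongr L v (glDiagonal 2 (LocalRing L v) ![1, hru.unit]) hru (formCongr_diagonal_antidiagTwo L v hru hrσ)).apply_symm_apply a.1) rfl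
      map_mul' := fun x y => Prod.ext (map_mul (cmDatumLocalCongr L v (glDiagonal 2 (LocalRing L v) ![1, hru.unit]) hru (formCongr_diagonal_antidiagTwo L v hru hrσ)) x.1 y.1) rfl
      continuous_toFun := ((cmDatumLocalCongr L v (glDiagonal 2 (LocalRing L v) ![1, hru.unit]) hru (formCongr_diagonal_antidiagTwo L v hru hrσ)).continuous.comp continuous_fst).prodMk continuous_snd
      continuous_invFun := ((cmDatumLocalCongr L v (glDiagonal 2 (LocalRing L v) ![1, hru.unit]) hru (formCongr_diagonal_antidiagTwo L v hru hrσ)).symm.continuous.comp continuous_fst).prodMk continuous_snd }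
  have he : ∀ a : ((cmDatum L 2 (Matrix.of fun i j : Fin 2 => if i.val + j.val + 1 = 2 then (1 : L) else 0)).Local v × (cmDatum L 1 (Matrix.of fun i j : Fin 1 => if i.val + j.val + 1 = 1 then (1 : L) else 0)).Local v), e a = ((cmDatumLocalCongr L v (glDiagonal 2 (LocalRing L v) ![1, hru.unit]) hru (formCongr_diagonal_antidiagTwo L v hru hrσ)) a.1, a.2) := fun a => rfl
  refine ⟨e, (glDiagonal 2 (LocalRing L v) ![1, hru.unit]) * P, fun a => by rw [he], fun t => ?_, fun t ht => ?_⟩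
  · rw [he]; exact partnerCongr_frame L v w hw hru hrσ t₀ P d ht₀ hP hd1 t
  · rw [he]; exact isLocalStablyConjH_partnerCongr_not_isConj L v w hw hru hrσ hrn t₀ P d ht₀ hP hd1 t ht

/-- **A STABLE PARTNER MAP ON AN ELLIPTIC REGULAR TORUS OF `H_v`** — the socket `τ` of ★ `rankOneUnstable_core_inert_of_eventually`, verbatim: at a non-split `v`,
for `t₀ ∈ H_v` with `t₀.1` regular and an eigenframe `t₀.1·P = P·diag d`, `σ(dᵢ) dᵢ = 1`, a CONTINUOUS `τ : Z(t₀) → H_v` with `τ t` stably conjugate and NOT conjugate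
to `t` for every `t ∈ Z(t₀)` with `t.1` regular (`τ = e|_{Z(t₀)}` for the automorphism `e = (Ad T_r, id)` of `exists_stablePartner_congr`).
[cite: Rogawski1990, §3.5 Prop. 3.5.2 (c) p. 29; §3.6 pp. 31–32; §4.9 Lemma 4.9.3 p. 56] [cite: LabesseLanglands1979, §2] -/
theorem exists_stablePartner (hv : Subsingleton (PlacesOver L v))
    (t₀ : ((cmDatum L 2 (Matrix.of fun i j : Fin 2 => if i.val + j.val + 1 = 2 then (1 : L) else 0)).Local v × (cmDatum L 1 (Matrix.of fun i j : Fin 1 => if i.val + j.val + 1 = 1 then (1 : L) else 0)).Local v)) (P : GL (Fin 2) (LocalRing L v)) (d : Fin 2 → (LocalRing L v)) (ht₀ : IsRegularElt (t₀.1.val : GL (Fin 2) (LocalRing L v)))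
    (hP : (t₀.1.val.val : Matrix (Fin 2) (Fin 2) (LocalRing L v)) * P.val = P.val * Matrix.diagonal d) (hd1 : ∀ i, conjLocal L (IsCMField.complexConj L) v (d i) * d i = 1) :
    ∃ τ : ↥(Subgroup.centralizer ({t₀} : Set ((cmDatum L 2 (Matrix.of fun i j : Fin 2 => if i.val + j.val + 1 = 2 then (1 : L) else 0)).Local v × (cmDatum L 1 (Matrix.of fun i j : Fin 1 => if i.val + j.val + 1 = 1 then (1 : L) else 0)).Local v))) → ((cmDatum L 2 (Matrix.of fun i j : Fin 2 => if i.val + j.val + 1 = 2 then (1 : L) else 0)).Local v × (cmDatum L 1 (Matrix.of fun i j : Fin 1 => if i.val + j.val + 1 = 1 then (1 : L) else 0)).Local v), Continuous τ ∧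
      ∀ t : ↥(Subgroup.centralizer ({t₀} : Set ((cmDatum L 2 (Matrix.of fun i j : Fin 2 => if i.val + j.val + 1 = 2 then (1 : L) else 0)).Local v × (cmDatum L 1 (Matrix.of fun i j : Fin 1 => if i.val + j.val + 1 = 1 then (1 : L) else 0)).Local v))), IsRegularElt ((t : ((cmDatum L 2 (Matrix.of fun i j : Fin 2 => if i.val + j.val + 1 = 2 then (1 : L) else 0)).Local v × (cmDatum L 1 (Matrix.of fun i j : Fin 1 => if i.val + j.val + 1 = 1 then (1 : L) else 0)).Local v)).1.val : GL (Fin 2) (LocalRing L v)) →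
        IsLocalStablyConjH L v (t : ((cmDatum L 2 (Matrix.of fun i j : Fin 2 => if i.val + j.val + 1 = 2 then (1 : L) else 0)).Local v × (cmDatum L 1 (Matrix.of fun i j : Fin 1 => if i.val + j.val + 1 = 1 then (1 : L) else 0)).Local v)) (τ t) ∧ ¬ IsConj (t : ((cmDatum L 2 (Matrix.of fun i j : Fin 2 => if i.val + j.val + 1 = 2 then (1 : L) else 0)).Local v × (cmDatum L 1 (Matrix.of fun i j : Fin 1 => if i.val + j.val + 1 = 1 then (1 : L) else 0)).Local v)) (τ t) := by
  obtain ⟨e, -, -, -, h⟩ := exists_stablePartner_congr L v hv t₀ P d ht₀ hP hd1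
  exact ⟨fun t => e (t : ((cmDatum L 2 (Matrix.of fun i j : Fin 2 => if i.val + j.val + 1 = 2 then (1 : L) else 0)).Local v × (cmDatum L 1 (Matrix.of fun i j : Fin 1 => if i.val + j.val + 1 = 1 then (1 : L) else 0)).Local v)), e.continuous.comp continuous_subtype_val, h⟩

end Partner

section Uniformizer

variable (L : Type) [Field L] [NumberField L] [IsCMField L] (v : HeightOneSpectrum (𝓞 ↥(maximalRealSubfield L)))

/-! ## §3 The uniformiser `ϖ_v` as the multiplier (architect RULING A-15 (c): `r₀ := ι_v ϖ_v`, `v_w(r₀) = exp(−1)` odd) -/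

/-- **`r₀ := ι_v(ϖ_v) ∈ L_v` IS A `σ`-FIXED NON-NORM UNIT OF ODD VALUATION** at a non-split place `v` unramified in `L`: `σ r₀ = r₀` (★ `conjLocal_toLocalRing`),
`v_w(r₀) = exp(−1)` at the place `w ∣ v` (★ `valued_toPlace_uniformizer_of_isUnramifiedIn`), hence `r₀` is a unit of the field `L_v` and NOT a norm `σ(z) z`
(norms have even valuation: `v_w(σ_w z · z) = v_w(z)²`, ★ `valued_galAdicCompletionMap`). [cite: Rogawski1990, §3.5 Prop. 3.5.2 (c) p. 29] [cite: Serre1979, Ch. V §2] -/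
theorem toLocalRing_uniformizer_nonNorm (hv : Subsingleton (PlacesOver L v)) (hunr : Algebra.IsUnramifiedIn (𝓞 L) v.asIdeal) :
    IsUnit (toLocalRing L v (HeckeCharacter.uniformizer ↥(maximalRealSubfield L) v : v.adicCompletion ↥(maximalRealSubfield L))) ∧
      (conjLocal L (IsCMField.complexConj L) v) (toLocalRing L v (HeckeCharacter.uniformizer ↥(maximalRealSubfield L) v : v.adicCompletion ↥(maximalRealSubfield L))) = (toLocalRing L v (HeckeCharacter.uniformizer ↥(maximalRealSubfield L) v : v.adicCompletion ↥(maximalRealSubfield L))) ∧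
      (¬ ∃ z : LocalRing L v, IsUnit z ∧ (toLocalRing L v (HeckeCharacter.uniformizer ↥(maximalRealSubfield L) v : v.adicCompletion ↥(maximalRealSubfield L))) = (conjLocal L (IsCMField.complexConj L) v) z * z) ∧
      ∀ w : PlacesOver L v, Valued.v ((toLocalRing L v (HeckeCharacter.uniformizer ↥(maximalRealSubfield L) v : v.adicCompletion ↥(maximalRealSubfield L))) w) = WithZero.exp (-1 : ℤ) := by
  classical
  obtain ⟨w⟩ := PlacesOver.nonempty L v
  have hw : IsCMField.complexConj L • w.1 = w.1 := smul_eq_of_subsingleton_placesOver₁₀ L v hv w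
  have hc1 : IsCMField.complexConj L ≠ 1 := IsCMField.complexConj_ne_one L
  letI : Field (LocalRing L v) := (LocalRing.isField_of_smul_eq (IsCMField.complexConj L) hc1 w hw).toField
  have hval : ∀ w' : PlacesOver L v, Valued.v ((toLocalRing L v (HeckeCharacter.uniformizer ↥(maximalRealSubfield L) v : v.adicCompletion ↥(maximalRealSubfield L))) w') = WithZero.exp (-1 : ℤ) := fun w' => by
    rw [toLocalRing_apply]
    exact Liu2021.LemD1IndexedNonVacuityInertCofinite.valued_toPlace_uniformizer_of_isUnramifiedIn L v hunr w'
  have hne : (toLocalRing L v (HeckeCharacter.uniformizer ↥(maximalRealSubfield L) v : v.adicCompletion ↥(maximalRealSubfield L))) ≠ 0 := fun h => by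
    have h1 := hval w
    rw [h, Pi.zero_apply, map_zero] at h1
    exact WithZero.exp_ne_zero h1.symm
  refine ⟨hne.isUnit, conjLocal_toLocalRing (IsCMField.complexConj L) v _, ?_, hval⟩
  rintro ⟨z, -, hz⟩
  have h1 := hval w
  rw [hz, Pi.mul_apply, conjLocal_apply_eq_of_smul_eq (IsCMField.complexConj L) hc1 v w hw z, map_mul, valued_galAdicCompletionMap] at h1
  rcases eq_or_ne (Valued.v (z w)) 0 with h0 | h0
  · rw [h0, mul_zero] at h1
    exact WithZero.exp_ne_zero h1.symm
  · rw [← WithZero.exp_log h0, ← WithZero.exp_add] at h1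
    have h2 := WithZero.exp_injective h1
    omega

/-- **THE STABLE PARTNER AUTOMORPHISM WITH THE UNIFORMISER AS MULTIPLIER** (`exists_stablePartner_congr` with the pin of architect RULING A-15 (c)): at a non-split
`v` unramified in `L`, `e = (Ad T, id) : H_v ≃ₜ* H_v` with `T = diag(1, r₀)`, `r₀ = ι_v(ϖ_v)` (odd valuation `exp(−1)`, `toLocalRing_uniformizer_nonNorm`):
`(e a).1 = T a.1 T⁻¹`, `(e a).2 = a.2`; for `t ∈ Z(t₀)` the frame of `(e t).1` is `T P` with the diagonal of `t.1`; and for `t.1` regular `e t` is stably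
conjugate and NOT conjugate to `t` (`partnerCongr_frame`, `isLocalStablyConjH_partnerCongr_not_isConj`).
[cite: Rogawski1990, §3.5 Prop. 3.5.2 (c) p. 29; §3.6 pp. 31–32; §4.9 Lemma 4.9.3 p. 56] [cite: LabesseLanglands1979, §2] -/
theorem exists_stablePartner_congr_uniformizer (hv : Subsingleton (PlacesOver L v)) (hunr : Algebra.IsUnramifiedIn (𝓞 L) v.asIdeal)
    (t₀ : ((cmDatum L 2 (Matrix.of fun i j : Fin 2 => if i.val + j.val + 1 = 2 then (1 : L) else 0)).Local v × (cmDatum L 1 (Matrix.of fun i j : Fin 1 => if i.val + j.val + 1 = 1 then (1 : L) else 0)).Local v)) (P : GL (Fin 2) (LocalRing L v)) (d : Fin 2 → (LocalRing L v)) (ht₀ : IsRegularElt (t₀.1.val : GL (Fin 2) (LocalRing L v)))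
    (hP : (t₀.1.val.val : Matrix (Fin 2) (Fin 2) (LocalRing L v)) * P.val = P.val * Matrix.diagonal d) (hd1 : ∀ i, conjLocal L (IsCMField.complexConj L) v (d i) * d i = 1) :
    ∃ (hr₀ : IsUnit (toLocalRing L v (HeckeCharacter.uniformizer ↥(maximalRealSubfield L) v : v.adicCompletion ↥(maximalRealSubfield L)))) (e : ((cmDatum L 2 (Matrix.of fun i j : Fin 2 => if i.val + j.val + 1 = 2 then (1 : L) else 0)).Local v × (cmDatum L 1 (Matrix.of fun i j : Fin 1 => if i.val + j.val + 1 = 1 then (1 : L) else 0)).Local v) ≃ₜ* ((cmDatum L 2 (Matrix.of fun i j : Fin 2 => if i.val + j.val + 1 = 2 then (1 : L) else 0)).Local v × (cmDatum L 1 (Matrix.of fun i j : Fin 1 => if i.val + j.val + 1 = 1 then (1 : L) else 0)).Local v)),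
      (∀ a : ((cmDatum L 2 (Matrix.of fun i j : Fin 2 => if i.val + j.val + 1 = 2 then (1 : L) else 0)).Local v × (cmDatum L 1 (Matrix.of fun i j : Fin 1 => if i.val + j.val + 1 = 1 then (1 : L) else 0)).Local v), (e a).2 = a.2) ∧
      (∀ a : ((cmDatum L 2 (Matrix.of fun i j : Fin 2 => if i.val + j.val + 1 = 2 then (1 : L) else 0)).Local v × (cmDatum L 1 (Matrix.of fun i j : Fin 1 => if i.val + j.val + 1 = 1 then (1 : L) else 0)).Local v), (e a).1.val = glDiagonal 2 (LocalRing L v) ![1, hr₀.unit] * a.1.val * (glDiagonal 2 (LocalRing L v) ![1, hr₀.unit])⁻¹) ∧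
      (∀ t : ↥(Subgroup.centralizer ({t₀} : Set ((cmDatum L 2 (Matrix.of fun i j : Fin 2 => if i.val + j.val + 1 = 2 then (1 : L) else 0)).Local v × (cmDatum L 1 (Matrix.of fun i j : Fin 1 => if i.val + j.val + 1 = 1 then (1 : L) else 0)).Local v))),
        ((e (t : ((cmDatum L 2 (Matrix.of fun i j : Fin 2 => if i.val + j.val + 1 = 2 then (1 : L) else 0)).Local v × (cmDatum L 1 (Matrix.of fun i j : Fin 1 => if i.val + j.val + 1 = 1 then (1 : L) else 0)).Local v))).1.val.val : Matrix (Fin 2) (Fin 2) (LocalRing L v)) * (glDiagonal 2 (LocalRing L v) ![1, hr₀.unit] * P).val =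
          (glDiagonal 2 (LocalRing L v) ![1, hr₀.unit] * P).val * Matrix.diagonal ![((P⁻¹).val * ((t : ((cmDatum L 2 (Matrix.of fun i j : Fin 2 => if i.val + j.val + 1 = 2 then (1 : L) else 0)).Local v × (cmDatum L 1 (Matrix.of fun i j : Fin 1 => if i.val + j.val + 1 = 1 then (1 : L) else 0)).Local v)).1.val.val : Matrix (Fin 2) (Fin 2) (LocalRing L v)) * P.val) 0 0, ((P⁻¹).val * ((t : ((cmDatum L 2 (Matrix.of fun i j : Fin 2 => if i.val + j.val + 1 = 2 then (1 : L) else 0)).Local v × (cmDatum L 1 (Matrix.of fun i j : Fin 1 => if i.val + j.val + 1 = 1 then (1 : L) else 0)).Local v)).1.val.val : Matrix (Fin 2) (Fin 2) (LocalRing L v)) * P.val) 1 1]) ∧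
      ∀ t : ↥(Subgroup.centralizer ({t₀} : Set ((cmDatum L 2 (Matrix.of fun i j : Fin 2 => if i.val + j.val + 1 = 2 then (1 : L) else 0)).Local v × (cmDatum L 1 (Matrix.of fun i j : Fin 1 => if i.val + j.val + 1 = 1 then (1 : L) else 0)).Local v))), IsRegularElt ((t : ((cmDatum L 2 (Matrix.of fun i j : Fin 2 => if i.val + j.val + 1 = 2 then (1 : L) else 0)).Local v × (cmDatum L 1 (Matrix.of fun i j : Fin 1 => if i.val + j.val + 1 = 1 then (1 : L) else 0)).Local v)).1.val : GL (Fin 2) (LocalRing L v)) →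
        IsLocalStablyConjH L v (t : ((cmDatum L 2 (Matrix.of fun i j : Fin 2 => if i.val + j.val + 1 = 2 then (1 : L) else 0)).Local v × (cmDatum L 1 (Matrix.of fun i j : Fin 1 => if i.val + j.val + 1 = 1 then (1 : L) else 0)).Local v)) (e (t : ((cmDatum L 2 (Matrix.of fun i j : Fin 2 => if i.val + j.val + 1 = 2 then (1 : L) else 0)).Local v × (cmDatum L 1 (Matrix.of fun i j : Fin 1 => if i.val + j.val + 1 = 1 then (1 : L) else 0)).Local v))) ∧ ¬ IsConj (t : ((cmDatum L 2 (Matrix.of fun i j : Fin 2 => if i.val + j.val + 1 = 2 then (1 : L) else 0)).Local v × (cmDatum L 1 (Matrix.of fun i j : Fin 1 => if i.val + j.val + 1 = 1 then (1 : L) else 0)).Local v)) (e (t : ((cmDatum L 2 (Matrix.of fun i j : Fin 2 => if i.val + j.val + 1 = 2 then (1 : L) else 0)).Local v × (cmDatum L 1 (Matrix.of fun i j : Fin 1 => if i.val + j.val + 1 = 1 then (1 : L) else 0)).Local v))) := by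
  classical
  obtain ⟨w⟩ := PlacesOver.nonempty L v
  have hw : IsCMField.complexConj L • w.1 = w.1 := smul_eq_of_subsingleton_placesOver₁₀ L v hv w
  obtain ⟨hru, hrσ, hrn, -⟩ := toLocalRing_uniformizer_nonNorm L v hv hunr
  let e : ((cmDatum L 2 (Matrix.of fun i j : Fin 2 => if i.val + j.val + 1 = 2 then (1 : L) else 0)).Local v × (cmDatum L 1 (Matrix.of fun i j : Fin 1 => if i.val + j.val + 1 = 1 then (1 : L) else 0)).Local v) ≃ₜ* ((cmDatum L 2 (Matrix.of fun i j : Fin 2 => if i.val + j.val + 1 = 2 then (1 : L) else 0)).Local v × (cmDatum L 1 (Matrix.of fun i j : Fin 1 => if i.val + j.val + 1 = 1 then (1 : L) else 0)).Local v) :=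
    { toFun := fun a => ((cmDatumLocalCongr L v (glDiagonal 2 (LocalRing L v) ![1, hru.unit]) hru (formCongr_diagonal_antidiagTwo L v hru hrσ)) a.1, a.2)
      invFun := fun a => ((cmDatumLocalCongr L v (glDiagonal 2 (LocalRing L v) ![1, hru.unit]) hru (formCongr_diagonal_antidiagTwo L v hru hrσ)).symm a.1, a.2)
      left_inv := fun a => Prod.ext ((cmDatumLocalCongr L v (glDiagonal 2 (LocalRing L v) ![1, hru.unit]) hru (formCongr_diagonal_antidiagTwo L v hru hrσ)).symm_apply_apply a.1) rfl
      right_inv := fun a => Prod.ext ((cmDatumLocalCongr L v (glDiagonal 2 (LocalRing L v) ![1, hru.unit]) hru (formCongr_diagonal_antidiagTwo L v hru hrσ)).apply_symm_apply a.1) rfl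
      map_mul' := fun x y => Prod.ext (map_mul (cmDatumLocalCongr L v (glDiagonal 2 (LocalRing L v) ![1, hru.unit]) hru (formCongr_diagonal_antidiagTwo L v hru hrσ)) x.1 y.1) rfl
      continuous_toFun := ((cmDatumLocalCongr L v (glDiagonal 2 (LocalRing L v) ![1, hru.unit]) hru (formCongr_diagonal_antidiagTwo L v hru hrσ)).continuous.comp continuous_fst).prodMk continuous_snd
      continuous_invFun := ((cmDatumLocalCongr L v (glDiagonal 2 (LocalRing L v) ![1, hru.unit]) hru (formCongr_diagonal_antidiagTwo L v hru hrσ)).symm.continuous.comp continuous_fst).prodMk continuous_snd }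
  have he : ∀ a : ((cmDatum L 2 (Matrix.of fun i j : Fin 2 => if i.val + j.val + 1 = 2 then (1 : L) else 0)).Local v × (cmDatum L 1 (Matrix.of fun i j : Fin 1 => if i.val + j.val + 1 = 1 then (1 : L) else 0)).Local v), e a = ((cmDatumLocalCongr L v (glDiagonal 2 (LocalRing L v) ![1, hru.unit]) hru (formCongr_diagonal_antidiagTwo L v hru hrσ)) a.1, a.2) :=
    fun a => rfl
  refine ⟨hru, e, fun a => by rw [he], fun a => ?_, fun t => ?_, fun t ht => ?_⟩
  · rw [he]; exact coe_cmDatumLocalCongr_apply L v _ hru (formCongr_diagonal_antidiagTwo L v hru hrσ) a.1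
  · rw [he]; exact partnerCongr_frame L v w hw hru hrσ t₀ P d ht₀ hP hd1 t
  · rw [he]; exact isLocalStablyConjH_partnerCongr_not_isConj L v w hw hru hrσ hrn t₀ P d ht₀ hP hd1 t ht

end Uniformizer





end Literature.NumberTheory.Rogawski1990

end
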